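import Summits.QuantumFields.YangMills.Theorems.UnitScaleTiltProp7TorusAgmonWeight
import HarnessLib

/-!
# Route `UnitScaleTilt`, crux K1 «MinimiserStabilityRegPr» (stmt-QuantumFields-19200), route-R E′ path (α′), (E1-b) at the CURVED background — (A-cov) MEMBER ROWS, part 2a «LETTER SIZES»:
# the WEIGHT size hypotheses of ✓p681742 `gen0_total_le` at `d = 3`: (i) the count of ✓ `exists_weight_rows`, `√((2(1 + 1∕(4κ∕(π√3·ℓ))))³) ≤ (5∕κ)·√(5∕κ)·ℓ·√ℓ` (`0 < κ ≤ 1 ≤ ℓ`;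
# i.e. `W₀ ≤ w·ℓ√ℓ` with `w = (5∕κ)^{3∕2}`); (ii) its size on the ball `tdist ≤ 9ℓ + ℓ`: `e^{κ(1 + tdist∕ℓ)} ≤ e^{11κ}` (`Ω := e^{11κ}`) — the cone-letter sizes `A₁ℓ² ≤ α` etc. are
# routeR-w4 g11's `cone_letter_sizes_member` (his v1.2 append to `…ConeRegaugeInst`), cited by name

Cell `ym3-torus`, width seat `ym3-torus-px22` (gen 3).  Pure real arithmetic (no member objects).  THEOREMS ONLY (0 `def`, 0 `sorry`);
`--supports stmt-QuantumFields-19200`, count-neutral.  YM₃ on T³ is a ladder rung (R3), not the Clay problem; nothing here claims the stub, the crux, d = 4 or the gap.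

References: T. Bałaban, CMP 99 (1985) 389–434 [Balaban1985BackgroundPropagators] ((3.35) p.396); CMP 96 (1984) 223–250 [Balaban1984PropagatorsII] ((1.9) p.226, (2.61) p.234).
-/

set_option autoImplicit false

noncomputable section

namespace Summit.QuantumFields.YangMills.Theorems.Prop7CovKernelMemberSizes

/-! ## §2 The weight count and its size on the ball -/

/-- **`π√3 ≤ 6`** (crude). [folklore] -/
theorem pi_mul_sqrt_three_le_six : Real.pi * Real.sqrt 3 ≤ 6 := by
  have hπ : Real.pi < 3.15 := Real.pi_lt_d2
  have h3 : Real.sqrt 3 ≤ 1.75 := by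
    rw [Real.sqrt_le_left (by norm_num)]
    norm_num
  nlinarith [Real.pi_pos.le, Real.sqrt_nonneg 3]

/-- ★★ **THE WEIGHT COUNT IS `≤ (5∕κ)√(5∕κ)·ℓ√ℓ`**: `√((2(1 + 1∕(4κ∕(π√3·ℓ))))³) ≤ (5∕κ)·√(5∕κ)·ℓ·√ℓ` for `0 < κ ≤ 1 ≤ ℓ` (✓ `exists_weight_rows`' count at `d = 3`).
[cite: Balaban1984PropagatorsII, (2.61) p.234] -/
theorem weight_count_le {κ ℓ : ℝ} (hκ0 : 0 < κ) (hκ1 : κ ≤ 1) (hℓ : 1 ≤ ℓ) :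
    Real.sqrt ((2 * (1 + 1 / (4 * κ / (Real.pi * Real.sqrt ((3 : ℕ) : ℝ) * ℓ)))) ^ (3 : ℕ)) ≤ (5 / κ) * Real.sqrt (5 / κ) * ℓ * Real.sqrt ℓ := by
  have hℓ0 : 0 < ℓ := by linarith
  have h3 : ((3 : ℕ) : ℝ) = 3 := by norm_num
  rw [h3]
  have hps := pi_mul_sqrt_three_le_six
  have hps0 : 0 ≤ Real.pi * Real.sqrt 3 := by positivity
  -- `2(1 + π√3ℓ/(4κ)) ≤ 5ℓ/κ`
  have hbase : 2 * (1 + 1 / (4 * κ / (Real.pi * Real.sqrt 3 * ℓ))) ≤ 5 * ℓ / κ := by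
    have e : 1 / (4 * κ / (Real.pi * Real.sqrt 3 * ℓ)) = Real.pi * Real.sqrt 3 * ℓ / (4 * κ) := by field_simp
    rw [e]
    rw [show 2 * (1 + Real.pi * Real.sqrt 3 * ℓ / (4 * κ)) = (8 * κ + 2 * (Real.pi * Real.sqrt 3) * ℓ) / (4 * κ) by field_simp; ring]
    rw [div_le_div_iff₀ (by positivity) hκ0]
    nlinarith [mul_le_mul_of_nonneg_right hps hℓ0.le, mul_le_mul hκ1 hℓ zero_le_one zero_le_one]
  have hbase0 : 0 ≤ 2 * (1 + 1 / (4 * κ / (Real.pi * Real.sqrt 3 * ℓ))) := by positivity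
  have hpow : (2 * (1 + 1 / (4 * κ / (Real.pi * Real.sqrt 3 * ℓ)))) ^ (3 : ℕ) ≤ (5 * ℓ / κ) ^ (3 : ℕ) := pow_le_pow_left₀ hbase0 hbase 3
  refine (Real.sqrt_le_sqrt hpow).trans (le_of_eq ?_)
  have h5 : 0 ≤ 5 / κ := by positivity
  have e1 : (5 * ℓ / κ) ^ (3 : ℕ) = ((5 / κ) * Real.sqrt (5 / κ) * ℓ * Real.sqrt ℓ) ^ 2 := by
    have hs1 : Real.sqrt (5 / κ) ^ 2 = 5 / κ := Real.sq_sqrt h5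
    have hs2 : Real.sqrt ℓ ^ 2 = ℓ := Real.sq_sqrt hℓ0.le
    calc (5 * ℓ / κ) ^ (3 : ℕ) = (5 / κ) ^ 2 * (5 / κ) * (ℓ ^ 2 * ℓ) := by ring
      _ = (5 / κ) ^ 2 * Real.sqrt (5 / κ) ^ 2 * (ℓ ^ 2 * Real.sqrt ℓ ^ 2) := by rw [hs1, hs2]
      _ = _ := by ring
  rw [e1, Real.sqrt_sq (by positivity)]

/-- **THE WEIGHT ON THE BALL**: `tdist ≤ 9ℓ + ℓ` ⇒ `e^{κ(1 + tdist∕ℓ)} ≤ e^{11κ}` (`κ ≥ 0`, `ℓ > 0`). [cite: Balaban1984PropagatorsII, (1.9) p.226] -/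
theorem weight_on_ball_le {κ ℓ t : ℝ} (hκ : 0 ≤ κ) (hℓ : 0 < ℓ) (ht : t ≤ 9 * ℓ + ℓ) :
    Real.exp (κ * (1 + t / ℓ)) ≤ Real.exp (11 * κ) := by
  refine Real.exp_le_exp.2 ?_
  have h1 : t / ℓ ≤ 10 := by rw [div_le_iff₀ hℓ]; linarith
  nlinarith

/-! ## §3 (v1.1) The member's Poincaré constant is `≤ c_A·ℓ_k²` -/

/-- ★★ **THE POINCARÉ CONSTANT OF px4's ✓ `sqrt_sum_hs_le_of_regPr'` IS `≤ c_A·ℓ_k²`** (pure arithmetic in its letters: `K_c` the cell constant, `q = ((2:ℕ):ℝ)^2`, `ℓ_k = L^k`,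
`(L⁻¹)^{2k} = ℓ_k⁻²`, frame row `τ₁·ℓ_k ≤ t`, `α₀ ≤ 1`, `d = 3`): `√(2(K_c q ℓ_k⁴ + (K_c q ℓ_k⁴(2d·α₀(L⁻¹)^{2k} + 8d·τ₁²))²)) ≤ √(2K_c q + 2(K_c q (6 + 24t²))²)·ℓ_k²` — the `A ≤ c_A·ℓ²`
hypothesis of ✓p681742 `gen0_total_le` at the member. [cite: Balaban1984PropagatorsII, (1.9) p.226] -/
theorem poincare_const_le {Kc q L α₀ τ₁ t : ℝ} {d k : ℕ} (hd : d = 3) (hKc : 0 ≤ Kc) (hq : 0 ≤ q) (hL : 1 ≤ L) (hα₀0 : 0 ≤ α₀) (hα₀ : α₀ ≤ 1)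
    (hτ0 : 0 ≤ τ₁) (hτ : τ₁ * L ^ k ≤ t) :
    Real.sqrt (2 * (Kc * q * (L ^ k) ^ 4 + (Kc * q * (L ^ k) ^ 4 * (2 * (d : ℝ) * (α₀ * (L⁻¹) ^ (2 * k)) + 8 * (d : ℝ) * τ₁ ^ 2)) ^ 2))
      ≤ Real.sqrt (2 * Kc * q + 2 * (Kc * q * (6 + 24 * t ^ 2)) ^ 2) * (L ^ k) ^ 2 := by
  subst hd
  have hℓ1 : (1 : ℝ) ≤ L ^ k := one_le_pow₀ hL
  have hℓ0 : (0 : ℝ) < L ^ k := by linarith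
  have ht0 : 0 ≤ t := le_trans (by positivity) hτ
  -- `α₀·(L⁻¹)^{2k}·ℓ_k² = α₀ ≤ 1` and `τ₁²·ℓ_k² ≤ t²`
  have hL0 : L ≠ 0 := by positivity
  have e1 : (L⁻¹) ^ (2 * k) * (L ^ k) ^ 2 = 1 := by
    have : (L⁻¹) ^ (2 * k) * (L ^ k) ^ 2 = (L⁻¹ * L) ^ (2 * k) := by ring
    rw [this, inv_mul_cancel₀ hL0, one_pow]
  have hin : (2 * ((3 : ℕ) : ℝ) * (α₀ * (L⁻¹) ^ (2 * k)) + 8 * ((3 : ℕ) : ℝ) * τ₁ ^ 2) * (L ^ k) ^ 2 ≤ 6 + 24 * t ^ 2 := by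
    have h3 : ((3 : ℕ) : ℝ) = 3 := by norm_num
    rw [h3]
    have a1 : α₀ * (L⁻¹) ^ (2 * k) * (L ^ k) ^ 2 = α₀ := by rw [mul_assoc, e1, mul_one]
    have a2 : τ₁ ^ 2 * (L ^ k) ^ 2 ≤ t ^ 2 := by
      rw [← mul_pow]; exact pow_le_pow_left₀ (by positivity) hτ 2
    nlinarith
  have hin0 : 0 ≤ 2 * ((3 : ℕ) : ℝ) * (α₀ * (L⁻¹) ^ (2 * k)) + 8 * ((3 : ℕ) : ℝ) * τ₁ ^ 2 := by positivity
  -- compare the radicands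
  have hcmp : 2 * (Kc * q * (L ^ k) ^ 4 + (Kc * q * (L ^ k) ^ 4 * (2 * ((3 : ℕ) : ℝ) * (α₀ * (L⁻¹) ^ (2 * k)) + 8 * ((3 : ℕ) : ℝ) * τ₁ ^ 2)) ^ 2)
      ≤ (Real.sqrt (2 * Kc * q + 2 * (Kc * q * (6 + 24 * t ^ 2)) ^ 2) * (L ^ k) ^ 2) ^ 2 := by
    have hr0 : 0 ≤ 2 * Kc * q + 2 * (Kc * q * (6 + 24 * t ^ 2)) ^ 2 := by positivity
    have esq : (Real.sqrt (2 * Kc * q + 2 * (Kc * q * (6 + 24 * t ^ 2)) ^ 2) * (L ^ k) ^ 2) ^ 2 = (2 * Kc * q + 2 * (Kc * q * (6 + 24 * t ^ 2)) ^ 2) * ((L ^ k) ^ 2) ^ 2 := by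
      rw [mul_pow, Real.sq_sqrt hr0]
    rw [esq]
    have b1 : Kc * q * (L ^ k) ^ 4 * (2 * ((3 : ℕ) : ℝ) * (α₀ * (L⁻¹) ^ (2 * k)) + 8 * ((3 : ℕ) : ℝ) * τ₁ ^ 2)
        = Kc * q * (L ^ k) ^ 2 * ((2 * ((3 : ℕ) : ℝ) * (α₀ * (L⁻¹) ^ (2 * k)) + 8 * ((3 : ℕ) : ℝ) * τ₁ ^ 2) * (L ^ k) ^ 2) := by ring
    have b2 : Kc * q * (L ^ k) ^ 2 * ((2 * ((3 : ℕ) : ℝ) * (α₀ * (L⁻¹) ^ (2 * k)) + 8 * ((3 : ℕ) : ℝ) * τ₁ ^ 2) * (L ^ k) ^ 2) ≤ Kc * q * (L ^ k) ^ 2 * (6 + 24 * t ^ 2) :=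
      mul_le_mul_of_nonneg_left hin (by positivity)
    have b0 : 0 ≤ Kc * q * (L ^ k) ^ 4 * (2 * ((3 : ℕ) : ℝ) * (α₀ * (L⁻¹) ^ (2 * k)) + 8 * ((3 : ℕ) : ℝ) * τ₁ ^ 2) := by positivity
    rw [b1] at b0 ⊢
    have b3 := pow_le_pow_left₀ b0 b2 2
    have e3 : (2 * Kc * q + 2 * (Kc * q * (6 + 24 * t ^ 2)) ^ 2) * ((L ^ k) ^ 2) ^ 2 = 2 * (Kc * q * (L ^ k) ^ 4) + 2 * (Kc * q * (L ^ k) ^ 2 * (6 + 24 * t ^ 2)) ^ 2 := by ring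
    rw [e3]
    linarith
  have hR0 : 0 ≤ Real.sqrt (2 * Kc * q + 2 * (Kc * q * (6 + 24 * t ^ 2)) ^ 2) * (L ^ k) ^ 2 := by positivity
  rw [← Real.sqrt_sq hR0]
  exact Real.sqrt_le_sqrt hcmp

end Summit.QuantumFields.YangMills.Theorems.Prop7CovKernelMemberSizes

end
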